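import Summits.QuantumFields.YangMills.Theorems.UnitScaleTiltProp7LODSlotK2MemberOfRegPr
import Summits.QuantumFields.YangMills.Theorems.UnitScaleTiltProp7LODSlotK2WindowLetters
import HarnessLib

/-!
# Route `UnitScaleTilt`, crux K1 «MinimiserStabilityRegPr» (stmt-QuantumFields-19200), EX row `hGF[Lift]` (curved member) — **LOD LINE, (L6) SLOT `hK₂`, PIECE (K2b): THE WINDOW
# LETTERS OF THE B-SERIES DISCHARGED K-UNIFORMLY** — ✓`Prop7LODSlotK2MemberOfRegPr.hKP_of_regPr'` (routeR-w4 g27, p759208) displays routeR-w2's Combes–Thomas slopes `0 < μ′ < μ`, `δ₁` and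
# the window∕gap rows `hδ`, `hwin`, `hgap` of ✓`kernelMatrix_blockBound_of_regPr` (p754496); this file CHOOSES `μ(am)`, `μ′(am)`, `δ₁(am)` as CLOSED TERMS of the massive mass `am`
# alone, proves the three rows for EVERY `η = L^{−(K−n)} ∈ (0,1]` at the chair's pin-(2) coarse weight `c₁ := c₀·(L³)^{K−n}`, and bounds the resulting `κP²` by `CP(am)∕(L^s)²` with
# `CP(am)` a CLOSED TERM OF `am` (no `K`, `n`, `L^{K−n}`, `|T³|`) — the `hKP` binder of px10 g11's ✓`Prop7LODAssemblyMember.curvedTarget_member[_of_hKP_hloc]` (p759065 ∕ v1.1) at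
# `κP := √(CP(am)∕(L^s)²)` and namer w2 g12's `hκP : κP² ≤ CP∕(L^s)²` of `…Prop7LODMemberWindow.coeff_ge_window_T3`, both by `exact`.

Cell `ym3-torus` (HUMAN RULING D-0037, YM ladder rung R3 — NOT d = 4, NOT infinite volume, NOT a mass gap, NOT Clay).  Width seat `ym-routeR-w4` gen 27 («MINE §2b» 2026-08-30 03:39:52Z,
w2 g12's 03:36:09Z «§2 still owes §2b»).  THEOREMS ONLY (0 `def`, 0 `sorry`); `--supports stmt-QuantumFields-19200 --as helper`, count-neutral.  HONEST LABEL (★★OWNER RULING №33 (6)):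
curved γ-row supplier line, (L6) assembly letters; REAL ARITHMETIC over landed rows — `e^y − 1 ≤ 3y` (`0 ≤ y ≤ 1`), hence `η⁻¹(e^{xη} − 1) ≤ 3x` for `η ≤ 1` (the K-uniformity), and
monotone bookkeeping of B6's printed constant.  HONEST SIZE: `CP(am)` is ASTRONOMICAL — `m_B = 2∕((33∕8)(600(27∕4)⁶ + am)) ≈ 8·10⁻⁹` at `am = 1`, the gap forces `μ′ ≤ m_B∕(3Γ) ≲ 10⁻¹³`,
and `S₁ ∝ μ′⁻⁴·m_B⁻²`, so `CP ~ 10^{190}`-class (routeR-w2 g12's FLAG OF RECORD 01:10Z made quantitative): w2 g12's scale `s₀ = ⌈log_L(…CP…)⌉` is ≈ 200, i.e. the LOD window closes only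
for members with `m + n > s₀`; every smaller member is the cover ∕ (α) road's ((c1) px17 g9, (c2) routeR-w3 g13, (c3) px10 g11).  Nothing of `hloc`, the window `γ > 0`, `hT`, `hGF`, EX ∕
19200 is proved here.

WHAT IS PROVED (ns `Summit.QuantumFields.YangMills.Theorems.Prop7LODSlotK2MemberWindow`).
* (the real-arithmetic letters — η-lemma, `window_delta`, `window_win`, `gap_le`, `window_gap`, `big_le` — are ✓∕⧗`…Prop7LODSlotK2WindowLetters`, this seat's companion file.)
* ★★★ `hKP_pin` — AT THE MEMBER (`n < K`, `U₀ ∈ 𝔘_k(ε₀)`, `10⁷L³ε₀ ≤ 1`, `Q″ + hseq`, scale `s`, massive mass `0 < am`):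
  `∀ χ N₂, ⟨site reading hN⟩ → ⟨step budget 2880∕(L^sL^{K−n})²⟩ → ∀ y, Σ_c ‖[R_{Q″}, N₂ c] y‖² ≤ (√(CP(am)∕((L:ℝ)^s)²))²·‖y‖²` = px10 g11's `hKP` binder TOKEN FOR TOKEN at
  `κP := √(CP(am)∕(L^s)²)`; `μ′ := min (μ∕2) (m_B∕(3Γ))`, `ν̄ := 2∕μ + 3Γ∕m_B`, `CP(am) = 2·2880·S₁max² + 72·2880·S₀max²`, `S₀max = C_βmax(2(1+ν̄))³`,
  `S₁max = C_βmax·2ν̄(2(1+2ν̄))³`, `C_βmax = (24·M·√(25∕8))²·(18∕m_B²)·(4(2(1+2∕μ))³)²`, `M = max 2 (16∕am)`.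

References: T. Bałaban, CMP **99** (1985) 389–434 [Balaban1985BackgroundPropagators] ((3.46) p.398, (3.49) p.399, Thm 3.11 p.416); CMP **119** (1988) 243–285 [Balaban1988RG2Cluster]
((2.7) p.13).
-/

set_option autoImplicit false

noncomputable section

open scoped BigOperators Matrix.Norms.L2Operator InnerProductSpace ComplexConjugate

namespace Summit.QuantumFields.YangMills.Theorems.Prop7LODSlotK2MemberWindow

open Literature.MathematicalPhysics.QuantumFieldTheory.Balaban1983to89
open Literature.MathematicalPhysics.QuantumFieldTheory.Balaban1983to89.T3ContinuumYM3Torus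
open T4Continuum BlockAveraging
open BlockAveraging (Idx)
open B7Prop1Explicit (disp)
open B10Eq27TorusAxialLog (holT transl)
open B7TransferAnalyticMean (meanCLM)
open B11Eq103H1Complex (SiteL2K BondL2K projR)
open Summit.QuantumFields.YangMills.Theorems.Prop8Chart (emlIterU)
open T3SectALandauChart (eta eta_pos bgUnits)
open T3PrintedRegularMinimiser (RegPr)
open Summit.QuantumFields.YangMills.Theorems.Prop7SectET3Transport (periodsT3)
open Summit.QuantumFields.YangMills.Theorems.Prop7SectET3HilbertLetters (W₂ toL2S covLapSite)
open Summit.QuantumFields.YangMills.Theorems.Prop7LODSlotK2MemberOfRegPr (hKP_of_regPr')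
open Summit.QuantumFields.YangMills.Theorems.Prop7LODSlotK2WindowLetters

/-! ## At the member: the (K2b) row with NO window letter displayed -/

variable (F : T3Family) {n K : ℕ} {c₀ : ℝ} [Fact (0 < c₀)]
  {ε₀ : ℝ} (hε₀ : 0 < ε₀) (hε7 : 10 ^ 7 * (F.L : ℝ) ^ 3 * ε₀ ≤ 1)
  (U₀ : GaugeField (F.P K) 0 (Matrix.specialUnitaryGroup (Fin 2) ℂ)) (hreg : RegPr F n K ε₀ U₀)
  (Q'' : SiteL2K ℂ 3 (periodsT3 F K) c₀ W₂ →ₗ[ℂ] (Site (F.P K) (K - n) → Matrix (Fin 2) (Fin 2) ℂ))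
  (hseq : ∀ lam : Site (F.P K) 0 → Matrix (Fin 2) (Fin 2) ℂ, ∃ ns : (j : ℕ) → Site (F.P K) j → Matrix (Fin 2) (Fin 2) ℂ, ns 0 = lam ∧
      (∀ (j : ℕ) (y : Site (F.P K) (j + 1)), ns (j + 1) y = ns j (emb y) - meanCLM (Idx (F.P K)) (Matrix (Fin 2) (Fin 2) ℂ) fun i : Idx (F.P K) =>
        ns j (emb y) - ((holT (emlIterU j (bgUnits F K U₀)) (emb y) (stairWord i.2.1 (off i.1)) : (Matrix (Fin 2) (Fin 2) ℂ)ˣ) : Matrix (Fin 2) (Fin 2) ℂ) *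
          ns j (transl (emb y) (disp (stairWord i.2.1 (off i.1)))) * (((holT (emlIterU j (bgUnits F K U₀)) (emb y) (stairWord i.2.1 (off i.1)))⁻¹ : (Matrix (Fin 2) (Fin 2) ℂ)ˣ) : Matrix (Fin 2) (Fin 2) ℂ)) ∧
      ns (K - n) = Q'' (toL2S F K c₀ lam))

include hε₀ hε7 hreg hseq in
/-- ★★★ **(K2b) AT THE MEMBER WITH THE WINDOW LETTERS DISCHARGED K-UNIFORMLY** — px10 g11's `hKP` binder of ✓`curvedTarget_member[_of_hKP_hloc]` TOKEN FOR TOKEN at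
`κP := √(CP(am)∕((L:ℝ)^s)²)`, `CP(am)` a closed term of the massive mass `am` alone (see the module docstring for its letters); hence also namer w2 g12's `hκP : κP² ≤ CP∕((L:ℝ)^s)²`
by `Real.sq_sqrt`.  Inputs: `n < K`, `U₀ ∈ 𝔘_k(ε₀)` with `10⁷L³ε₀ ≤ 1`, `Q″ + hseq` (clause (iv)), the cut-off scale `s`, `0 < am`; inside: ✓`hKP_of_regPr'` at `c₁ := c₀(L³)^{K−n}`,
`μ := 1∕(10√M√(27 + (2025∕8)am))`, `δ₁ := √(27 + (2025∕8)am)·μ`, `μ′ := min (μ∕2) (m_B∕(3Γ))`, and §1.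
[cite: Balaban1985BackgroundPropagators, Thm 3.1 (3.46) p.398, (3.49) p.399, (3.100) pp.413–414, Thm 3.11 p.416; Balaban1988RG2Cluster, (2.7) p.13] -/
theorem hKP_pin (hnK : n < K) (s : ℕ) {am : ℝ} (ham : 0 < am) :
    ∀ (χ : Site (F.P K) 0 → Site (F.P K) 0 → ℝ) (N₂ : Site (F.P K) 0 → (SiteL2K ℂ 3 (periodsT3 F K) c₀ W₂ →ₗ[ℂ] SiteL2K ℂ 3 (periodsT3 F K) c₀ W₂)),
      (∀ (c : Site (F.P K) 0) (φ : SiteL2K ℂ 3 (periodsT3 F K) c₀ W₂) (x : Site (F.P K) 0), (toL2S F K c₀).symm (N₂ c φ) x = χ c x • (toL2S F K c₀).symm φ x) →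
      (∀ (x : Site (F.P K) 0) (μ : Fin (F.P K).d), ∑ c : Site (F.P K) 0, (χ c (x.shift μ) - χ c x) ^ 2 ≤ (2880 / ((F.L : ℝ) ^ s * (F.L : ℝ) ^ (K - n)) ^ 2)) →
      ∀ y : SiteL2K ℂ 3 (periodsT3 F K) c₀ W₂,
        ∑ c : Site (F.P K) 0, ‖projR (covLapSite F n K c₀ U₀) Q'' (N₂ c y) - N₂ c (projR (covLapSite F n K c₀ U₀) Q'' y)‖ ^ 2
          ≤ Real.sqrt ((2 * 2880 * (((24 * (max 2 (16 / am)) * Real.sqrt (25 / 8)) ^ 2 * (18 / (2 / ((1 + 25 / 8) * (600 * (27 / 4 : ℝ) ^ 6 + am))) ^ 2) * (4 * (2 * (1 + 2 / (1 / (10 * Real.sqrt (max 2 (16 / am)) * Real.sqrt (27 + 2025 / 8 * am))))) ^ 3) ^ 2) * (2 * (2 / (1 / (10 * Real.sqrt (max 2 (16 / am)) * Real.sqrt (27 + 2025 / 8 * am))) + 3 * ((Real.sqrt (max 2 (16 / am)) * (2 + Real.sqrt (max 2 (16 / am))) * (3 * Real.sqrt 3 + 27 + 9 * Real.sqrt am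 * Real.sqrt (25 / 8) + 81 * am * (25 / 8))
          * (8 * Real.sqrt (max 2 (16 / am)) + 8 * Real.sqrt (max 2 (16 / am)) ^ 2) * (10 * Real.sqrt (25 / 8)) + 9 * (max 2 (16 / am)) * Real.sqrt (25 / 8))) / (2 / ((1 + 25 / 8) * (600 * (27 / 4 : ℝ) ^ 6 + am)))) * (2 * (1 + 2 * (2 / (1 / (10 * Real.sqrt (max 2 (16 / am)) * Real.sqrt (27 + 2025 / 8 * am))) + 3 * ((Real.sqrt (max 2 (16 / am)) * (2 + Real.sqrt (max 2 (16 / am))) * (3 * Real.sqrt 3 + 27 + 9 * Real.sqrt am * Real.sqrt (25 / 8) + 81 * am * (25 / 8))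
          * (8 * Real.sqrt (max 2 (16 / am)) + 8 * Real.sqrt (max 2 (16 / am)) ^ 2) * (10 * Real.sqrt (25 / 8)) + 9 * (max 2 (16 / am)) * Real.sqrt (25 / 8))) / (2 / ((1 + 25 / 8) * (600 * (27 / 4 : ℝ) ^ 6 + am)))))) ^ 3)) ^ 2 + 72 * 2880 * (((24 * (max 2 (16 / am)) * Real.sqrt (25 / 8)) ^ 2 * (18 / (2 / ((1 + 25 / 8) * (600 * (27 / 4 : ℝ) ^ 6 + am))) ^ 2) * (4 * (2 * (1 + 2 / (1 / (10 * Real.sqrt (max 2 (16 / am)) * Real.sqrt (27 + 2025 / 8 * am))))) ^ 3) ^ 2) * (2 * (1 + (2 / (1 / (10 * Real.sqrt (max 2 (16 / am)) * Real.sqrt (27 + 2025 / 8 * am))) + 3 * ((Real.sqrt (max 2 (16 / am)) * (2 + Real.sqrt (max 2 (16 / am))) * (3 * Real.sqrt 3 + 27 + 9 * Real.sqrt am * Real.sqrt (25 / 8) + 81 * am * (25 / 8))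
          * (8 * Real.sqrt (max 2 (16 / am)) + 8 * Real.sqrt (max 2 (16 / am)) ^ 2) * (10 * Real.sqrt (25 / 8)) + 9 * (max 2 (16 / am)) * Real.sqrt (25 / 8))) / (2 / ((1 + 25 / 8) * (600 * (27 / 4 : ℝ) ^ 6 + am)))))) ^ 3) ^ 2)
              / ((F.L : ℝ) ^ s) ^ 2) ^ 2 * ‖y‖ ^ 2 := by
  intro χ N₂ hN hfam y
  have hc₀ : 0 < c₀ := Fact.out
  have hL1 : (1 : ℝ) < F.L := by exact_mod_cast F.hL.2
  have hL0 : (0 : ℝ) < F.L := by linarith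
  haveI : Fact (0 < c₀ * ((F.L : ℝ) ^ 3) ^ (K - n)) := ⟨by positivity⟩
  -- the chair's pins at `c₁ := c₀(L³)^(K−n)`: the three raw letters are K-free numbers
  have hsx : (25 / 8) * (c₀ * ((F.L : ℝ) ^ 3) ^ (K - n) * ((((F.P K).L : ℝ) ^ (F.P K).d) ^ (K - n))⁻¹ / c₀) = 25 / 8 := by
    rw [show ((F.P K).L : ℝ) = (F.L : ℝ) from rfl, T3Family.P_d]; field_simp
  have hMraw : 16 * c₀ * ((F.L : ℝ) ^ (K - n)) ^ 3 / (am * (c₀ * ((F.L : ℝ) ^ 3) ^ (K - n))) = 16 / am := by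
    rw [← pow_mul, ← pow_mul, Nat.mul_comm]; field_simp
  have hM : max 2 (16 * c₀ * ((F.L : ℝ) ^ (K - n)) ^ 3 / (am * (c₀ * ((F.L : ℝ) ^ 3) ^ (K - n)))) = max 2 (16 / am) := by rw [hMraw]
  have hdEx : 600 * (27 / 4 : ℝ) ^ 6 * (c₀ * ((F.L : ℝ) ^ 3) ^ (K - n) / (c₀ * ((F.L : ℝ) ^ 3) ^ (K - n))) = 600 * (27 / 4 : ℝ) ^ 6 := by
    rw [div_self (by positivity), mul_one]
  have hη : 0 < eta F n K := eta_pos F n K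
  have hη1 : eta F n K ≤ 1 := by
    show ((F.L : ℝ)⁻¹) ^ (K - n) ≤ 1
    exact pow_le_one₀ (inv_nonneg.2 hL0.le) (inv_le_one_of_one_le₀ hL1.le)
  have hℓ : (1 : ℝ) ≤ (F.L : ℝ) ^ (K - n) := one_le_pow₀ hL1.le
  have hLs : (0 : ℝ) < (F.L : ℝ) ^ s := pow_pos hL0 s
  have hdd : ((F.P K).d : ℝ) = 3 := by rw [T3Family.P_d]; norm_num
  -- the closed letters of the massive mass `am`
  set M' : ℝ := max 2 (16 / am) with hM'def
  have hM'2 : 2 ≤ M' := le_max_left _ _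
  set cδ : ℝ := 27 + 2025 / 8 * am with hcδdef
  have hcδ1 : 1 ≤ cδ := by rw [hcδdef]; linarith [ham.le]
  set μ : ℝ := 1 / (10 * Real.sqrt M' * Real.sqrt cδ) with hμdef
  have hsM1 : 1 ≤ Real.sqrt M' := Real.one_le_sqrt.2 (by linarith)
  have hsc1 : 1 ≤ Real.sqrt cδ := Real.one_le_sqrt.2 hcδ1
  have hμ0 : 0 < μ := by rw [hμdef]; positivity
  have hμ10 : 10 * μ ≤ 1 := by
    rw [hμdef]
    have h1 : (1 : ℝ) ≤ Real.sqrt M' * Real.sqrt cδ := one_le_mul_of_one_le_of_one_le hsM1 hsc1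
    have hpos : 0 < 10 * Real.sqrt M' * Real.sqrt cδ := by positivity
    rw [show 10 * (1 / (10 * Real.sqrt M' * Real.sqrt cδ)) = 1 / (Real.sqrt M' * Real.sqrt cδ) by field_simp]
    rw [div_le_one (by positivity)]
    exact h1
  have hμ3 : 3 * μ ≤ 1 := by linarith
  set Γ : ℝ := (Real.sqrt (max 2 (16 / am)) * (2 + Real.sqrt (max 2 (16 / am))) * (3 * Real.sqrt 3 + 27 + 9 * Real.sqrt am * Real.sqrt (25 / 8) + 81 * am * (25 / 8))
          * (8 * Real.sqrt (max 2 (16 / am)) + 8 * Real.sqrt (max 2 (16 / am)) ^ 2) * (10 * Real.sqrt (25 / 8)) + 9 * (max 2 (16 / am)) * Real.sqrt (25 / 8)) with hΓdef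
  have hΓ : 0 < Γ := by rw [hΓdef]; positivity
  set mBc : ℝ := (2 / ((1 + 25 / 8) * (600 * (27 / 4 : ℝ) ^ 6 + am))) with hmBcdef
  have hmBc : 0 < mBc := by rw [hmBcdef]; positivity
  set μ' : ℝ := min (μ / 2) (mBc / (3 * Γ)) with hμ'def
  have hμ'0 : 0 < μ' := lt_min (by linarith) (by positivity)
  have hμ'le : μ' ≤ μ / 2 := min_le_left _ _
  have hμ'lt : μ' < μ := by linarith
  have hμ'3 : 3 * μ' ≤ 1 := by linarith
  have hμ'Γ' : μ' ≤ mBc / (3 * Γ) := min_le_right _ _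
  set ν : ℝ := 2 / μ + 3 * Γ / mBc with hνdef
  have hν : 1 / μ' ≤ ν := by
    rw [one_div, hμ'def, hνdef]
    have h2μ : (0 : ℝ) < 2 / μ := by positivity
    have h3Γ : (0 : ℝ) < 3 * Γ / mBc := by positivity
    rcases le_total (μ / 2) (mBc / (3 * Γ)) with h | h
    · rw [min_eq_left h, inv_div]; linarith
    · rw [min_eq_right h, inv_div]; linarith
  -- the window rows at the raw letters
  have hδ := window_delta (a := am) (sx := ((25 / 8) * (c₀ * ((F.L : ℝ) ^ 3) ^ (K - n) * ((((F.P K).L : ℝ) ^ (F.P K).d) ^ (K - n))⁻¹ / c₀))) (η := eta F n K) ham hsx hη hη1 hμ0.le hμ3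
  have hwin := window_win ham hM
  have hG0 := gap_nonneg (a := am) (sx := ((25 / 8) * (c₀ * ((F.L : ℝ) ^ 3) ^ (K - n) * ((((F.P K).L : ℝ) ^ (F.P K).d) ^ (K - n))⁻¹ / c₀))) (η := eta F n K)
    (M := max 2 (16 * c₀ * ((F.L : ℝ) ^ (K - n)) ^ 3 / (am * (c₀ * ((F.L : ℝ) ^ 3) ^ (K - n))))) (μ' := μ') ham hη (by positivity) hμ'0.le
  have hGle := gap_le (a := am) (sx := ((25 / 8) * (c₀ * ((F.L : ℝ) ^ 3) ^ (K - n) * ((((F.P K).L : ℝ) ^ (F.P K).d) ^ (K - n))⁻¹ / c₀))) (η := eta F n K)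
    (M := max 2 (16 * c₀ * ((F.L : ℝ) ^ (K - n)) ^ 3 / (am * (c₀ * ((F.L : ℝ) ^ 3) ^ (K - n))))) (μ' := μ') ham hsx hη hη1 hM hμ'0.le hμ'3
  have hmBraw : (2 / ((1 + ((25 / 8) * (c₀ * ((F.L : ℝ) ^ 3) ^ (K - n) * ((((F.P K).L : ℝ) ^ (F.P K).d) ^ (K - n))⁻¹ / c₀))) * ((600 * (27 / 4 : ℝ) ^ 6 * (c₀ * ((F.L : ℝ) ^ 3) ^ (K - n) / (c₀ * ((F.L : ℝ) ^ 3) ^ (K - n)))) + am))) = mBc := by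
    rw [hsx, hdEx]
  have hμ'Γ : μ' ≤ (2 / ((1 + ((25 / 8) * (c₀ * ((F.L : ℝ) ^ 3) ^ (K - n) * ((((F.P K).L : ℝ) ^ (F.P K).d) ^ (K - n))⁻¹ / c₀))) * ((600 * (27 / 4 : ℝ) ^ 6 * (c₀ * ((F.L : ℝ) ^ 3) ^ (K - n) / (c₀ * ((F.L : ℝ) ^ 3) ^ (K - n)))) + am))) / (3 * Γ) := by
    rw [hmBraw]; exact hμ'Γ'
  obtain ⟨hgap, hP2pos, hP2⟩ := window_gap hG0 hGle hΓ (by rw [hmBraw]; exact hmBc) hμ'Γ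
  -- the (K2b) row at these letters, and the K-free bound of its bracket
  have hbig := big_le (a := am) (sx := ((25 / 8) * (c₀ * ((F.L : ℝ) ^ 3) ^ (K - n) * ((((F.P K).L : ℝ) ^ (F.P K).d) ^ (K - n))⁻¹ / c₀))) (dEx := (600 * (27 / 4 : ℝ) ^ 6 * (c₀ * ((F.L : ℝ) ^ 3) ^ (K - n) / (c₀ * ((F.L : ℝ) ^ 3) ^ (K - n))))) (η := eta F n K)
    (M := max 2 (16 * c₀ * ((F.L : ℝ) ^ (K - n)) ^ 3 / (am * (c₀ * ((F.L : ℝ) ^ 3) ^ (K - n))))) (μ := μ) (μ' := μ') (ℓ := (F.L : ℝ) ^ (K - n)) (Ls := (F.L : ℝ) ^ s)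
    (dd := ((F.P K).d : ℝ)) (ν := ν) ham hsx hdEx hM hμ0 hμ10 hμ'0 hμ'le hν hP2 hP2pos hℓ hLs hdd
  rw [Real.sq_sqrt (by positivity)]
  refine (hKP_of_regPr' F hε₀ hε7 U₀ hreg Q'' hseq ham hnK hμ'0 hμ'lt (c₁ := c₀ * ((F.L : ℝ) ^ 3) ^ (K - n))
    (δ₁ := Real.sqrt cδ * μ) (by positivity) hδ hwin hgap χ hfam N₂ hN y).trans ?_
  exact mul_le_mul_of_nonneg_right hbig (sq_nonneg _)

end Summit.QuantumFields.YangMills.Theorems.Prop7LODSlotK2MemberWindow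

end
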